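import Summits.AnomalousDissipation.AnomalousDissipation.Theorems.MomentParityQuarticGateAtomRows
import Summits.AnomalousDissipation.AnomalousDissipation.Theorems.MomentParityQuarticGateCoords
import Summits.AnomalousDissipation.AnomalousDissipation.Theorems.MomentParityQuarticGatePairCalculus
import Summits.AnomalousDissipation.AnomalousDissipation.Theorems.MomentParityQuarticGateFourierDictionary
import Literature.Algebra.Polynomial.FischerInnerProduct
import Mathlib.RingTheory.MvPolynomial.EulerIdentity

/-!
# Coefficient bridge for `MomentParity.CubicParityLoud` (stmt-AnomalousDissipation-11465), helper I:
# the kernel of a quadratic observable and the Fourier dictionary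

Support file (`--supports stmt-AnomalousDissipation-11465`) for the stub `stub_coefficientBridge` (S3c) of the
line `farkas-split-menu`: the PARSEVAL DICTIONARY between the coefficient side (kernels
`A k l : ℂ³ →ₗ[ℂ] ℂ³`, admissible coefficient families `c` on the punctured ball `S = (freqBall N).erase 0`)
and the test side (homogeneous quadratic cylindrical observables `p(u) = P((u,g₁),…,(u,gₘ))` with band
tests `gᵢ`, level-`N` fields `u ∈ H`). Contents, all elementary:

* algebra of conjugate-symmetric families on a symmetric `S`: `Σ_{k∈S} ⟪p k, q k⟫_ℂ` is real
  (`sum_inner_eq_ofReal`); the curl symbol `c k ↦ 2πi k × c k` is additive, Hermitian on each fibre,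
  transversal and conjugate symmetric;
* the symmetric coefficient matrix `M` of a homogeneous quadratic `P` (`∂ᵢP(y) = Σⱼ Mᵢⱼ yⱼ`,
  `exists_symm_matrix_of_isHomogeneous_two`);
* the KERNEL `A k l = Σᵢⱼ (Mᵢⱼ/2) ⟪ĝⱼ l, ·⟫ ĝᵢ k` of the observable and its real form
  `Σ_{k,l∈S} Re⟪p k, A k l (q l)⟫ = Σᵢⱼ (Mᵢⱼ/2) Yᵢ(p) Yⱼ(q)`, `Yᵢ(p) = Σ_{k∈S} Re⟪p k, ĝᵢ k⟫`
  (`sum_sum_re_inner_kernel`, `form_add_form_swap`);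
* the dictionary `u ↔ û` for level-`N` fields of `H` (`coe_ae_eq_realTrigPoly_of_level`,
  `exists_level_of_admissible`) and the Euler derivative of a combination of band tests in coefficients
  (`nsGeneratorPairing_zero_zero_sum_smul_eq`).
-/

namespace Summit.AnomalousDissipation.AnomalousDissipation.Theorems.MomentParityCubicParityLoud

open MeasureTheory Filter UnitAddTorus
open scoped InnerProductSpace RealInnerProductSpace ENNReal ComplexConjugate
open Literature.Analysis.FunctionSpaces Literature.Analysis.FluidPDE
open Summit.AnomalousDissipation.AnomalousDissipation.Theses.MomentParity
open Summit.AnomalousDissipation.AnomalousDissipation.Theorems.MomentParityQuarticGate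

-- `Summit.<Summit>.<Problem>` is the tree's mandated summit-side namespace (CONVENTIONS §2); for this
-- single-conjunct summit the two coincide, so the duplicate is deliberate.
set_option linter.dupNamespace false

namespace CoefficientBridge

/-! ## Algebra of coefficient families -/

/-- `⟪conj v, conj w⟫_ℂ = conj ⟪v, w⟫_ℂ` for the coordinatewise conjugation on `ℂ^ι`. [folklore] -/
theorem inner_conjVec_conjVec {ι : Type*} [Fintype ι] (v w : EuclideanSpace ℂ ι) :
    inner ℂ (EuclideanSpace.conjVec v) (EuclideanSpace.conjVec w) = conj (inner ℂ v w) := by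
  simp only [PiLp.inner_apply, EuclideanSpace.conjVec_apply, RCLike.inner_apply, map_sum, map_mul,
    Complex.conj_conj]

/-- `Re ⟪x, y⟫ = Re ⟪y, x⟫`. [folklore] -/
theorem re_inner_comm (x y : EuclideanSpace ℂ (Fin 3)) : (inner ℂ x y).re = (inner ℂ y x).re := by
  rw [← inner_conj_symm, Complex.conj_re]

/-- On a symmetric frequency set the `ℓ²(S)` pairing of two conjugate-symmetric families is real:
`conj (Σ_{k∈S} ⟪p k, q k⟫) = Σ_{k∈S} ⟪p k, q k⟫` (reindex `k ↦ -k`). [folklore] -/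
theorem conj_sum_inner_eq {S : Finset (Fin 3 → ℤ)} (hS : ∀ k ∈ S, -k ∈ S)
    {p q : (Fin 3 → ℤ) → EuclideanSpace ℂ (Fin 3)} (hp : Torus.IsConjSymm p)
    (hq : Torus.IsConjSymm q) :
    conj (∑ k ∈ S, inner ℂ (p k) (q k)) = ∑ k ∈ S, inner ℂ (p k) (q k) := by
  calc conj (∑ k ∈ S, inner ℂ (p k) (q k)) = ∑ k ∈ S, conj (inner ℂ (p k) (q k)) := map_sum _ _ _
    _ = ∑ k ∈ S, inner ℂ (p (-k)) (q (-k)) :=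
        Finset.sum_congr rfl fun k _ => by rw [hp k, hq k, inner_conjVec_conjVec]
    _ = ∑ k ∈ S, inner ℂ (p k) (q k) :=
        Finset.sum_nbij' (fun k => -k) (fun k => -k) hS hS (fun k _ => neg_neg k)
          (fun k _ => neg_neg k) fun _ _ => rfl

/-- Hence `Σ_{k∈S} ⟪p k, q k⟫_ℂ = Σ_{k∈S} Re ⟪p k, q k⟫` as a complex number. [folklore] -/
theorem sum_inner_eq_ofReal {S : Finset (Fin 3 → ℤ)} (hS : ∀ k ∈ S, -k ∈ S)
    {p q : (Fin 3 → ℤ) → EuclideanSpace ℂ (Fin 3)} (hp : Torus.IsConjSymm p)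
    (hq : Torus.IsConjSymm q) :
    ∑ k ∈ S, inner ℂ (p k) (q k) = ((∑ k ∈ S, (inner ℂ (p k) (q k)).re : ℝ) : ℂ) := by
  rw [← Complex.re_sum]
  exact (Complex.conj_eq_iff_re.1 (conj_sum_inner_eq hS hp hq)).symm

/-! ## The curl symbol `c k ↦ 2πi k × c k` -/

/-- **The curl symbol is Hermitian on each fibre**: `⟪c k, 2πi k × c' k⟫ = ⟪2πi k × c k, c' k⟫`
(`k` is real and `v ↦ k × v` is antisymmetric). [folklore] -/
theorem inner_curlCoeff_comm (c c' : (Fin 3 → ℤ) → EuclideanSpace ℂ (Fin 3)) (k : Fin 3 → ℤ) :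
    inner ℂ (c k) (IntermittentBeltrami.curlCoeff c' k) =
      inner ℂ (IntermittentBeltrami.curlCoeff c k) (c' k) := by
  obtain ⟨h0, h1, h2⟩ := IntermittentBeltrami.cross_apply_fin (fun j => ((k j : ℤ) : ℂ)) (WithLp.ofLp (c k))
  obtain ⟨h0', h1', h2'⟩ :=
    IntermittentBeltrami.cross_apply_fin (fun j => ((k j : ℤ) : ℂ)) (WithLp.ofLp (c' k))
  simp only [PiLp.inner_apply, RCLike.inner_apply, Fin.sum_univ_three,
    IntermittentBeltrami.curlCoeff_apply, h0, h1, h2, h0', h1', h2', map_mul, map_sub, map_ofNat,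
    Complex.conj_ofReal, Complex.conj_I, map_intCast]
  ring

/-- **The curl symbol is transversal**: `Σᵢ kᵢ (2πi k × v)ᵢ = 0`. [folklore] -/
theorem sum_mul_curlCoeff_apply (c : (Fin 3 → ℤ) → EuclideanSpace ℂ (Fin 3)) (k : Fin 3 → ℤ) :
    ∑ i, (k i : ℂ) * IntermittentBeltrami.curlCoeff c k i = 0 := by
  obtain ⟨h0, h1, h2⟩ := IntermittentBeltrami.cross_apply_fin (fun j => ((k j : ℤ) : ℂ)) (WithLp.ofLp (c k))
  simp only [Fin.sum_univ_three, IntermittentBeltrami.curlCoeff_apply, h0, h1, h2]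
  ring

/-- **The curl symbol of a conjugate-symmetric family is conjugate symmetric** (the curl of a real
field is real). [folklore] -/
theorem isConjSymm_curlCoeff {c : (Fin 3 → ℤ) → EuclideanSpace ℂ (Fin 3)} (hc : Torus.IsConjSymm c) :
    Torus.IsConjSymm (IntermittentBeltrami.curlCoeff c) := by
  intro k
  obtain ⟨h0, h1, h2⟩ :=
    IntermittentBeltrami.cross_apply_fin (fun j => (((-k) j : ℤ) : ℂ)) (WithLp.ofLp (c (-k)))
  obtain ⟨h0', h1', h2'⟩ := IntermittentBeltrami.cross_apply_fin (fun j => ((k j : ℤ) : ℂ)) (WithLp.ofLp (c k))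
  have hck : ∀ j, c (-k) j = conj (c k j) := fun j => by
    rw [hc k, EuclideanSpace.conjVec_apply]
  ext i
  fin_cases i
  · simp only [Fin.zero_eta, IntermittentBeltrami.curlCoeff_apply, EuclideanSpace.conjVec_apply]
    rw [h0, h0']
    simp only [hck, Pi.neg_apply, Int.cast_neg, map_mul, map_sub, map_ofNat, Complex.conj_ofReal,
      Complex.conj_I, map_intCast]
    ring
  · simp only [Fin.mk_one, IntermittentBeltrami.curlCoeff_apply, EuclideanSpace.conjVec_apply]
    rw [h1, h1']
    simp only [hck, Pi.neg_apply, Int.cast_neg, map_mul, map_sub, map_ofNat, Complex.conj_ofReal,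
      Complex.conj_I, map_intCast]
    ring
  · simp only [Fin.reduceFinMk, IntermittentBeltrami.curlCoeff_apply, EuclideanSpace.conjVec_apply]
    rw [h2, h2']
    simp only [hck, Pi.neg_apply, Int.cast_neg, map_mul, map_sub, map_ofNat, Complex.conj_ofReal,
      Complex.conj_I, map_intCast]
    ring

/-! ## The symmetric coefficient matrix of a homogeneous quadratic polynomial -/

/-- **Hessian of a quadratic form.** A homogeneous quadratic `P` in `m` variables has a symmetric real
matrix `M` (`Mᵢⱼ = ∂ⱼ∂ᵢP`) with `∂ᵢP(y) = Σⱼ Mᵢⱼ yⱼ` (Euler's identity applied to the linear forms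
`∂ᵢP`; symmetry is `∂ᵢ∂ⱼ = ∂ⱼ∂ᵢ`). [folklore] -/
theorem exists_symm_matrix_of_isHomogeneous_two {m : ℕ} {P : MvPolynomial (Fin m) ℝ}
    (hP : P.IsHomogeneous 2) :
    ∃ M : Fin m → Fin m → ℝ, (∀ i j, M i j = M j i) ∧
      ∀ (y : Fin m → ℝ) (i : Fin m),
        MvPolynomial.eval y (MvPolynomial.pderiv i P) = ∑ j, M i j * y j := by
  classical
  refine ⟨fun i j => MvPolynomial.coeff 0 (MvPolynomial.pderiv j (MvPolynomial.pderiv i P)),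
    fun i j => by
      show MvPolynomial.coeff 0 (MvPolynomial.pderiv j (MvPolynomial.pderiv i P)) =
        MvPolynomial.coeff 0 (MvPolynomial.pderiv i (MvPolynomial.pderiv j P))
      rw [Literature.Algebra.Polynomial.pderiv_pderiv_comm j i P], fun y i => ?_⟩
  have h1 : (MvPolynomial.pderiv i P).IsHomogeneous 1 := hP.pderiv
  have hC : ∀ j, MvPolynomial.pderiv j (MvPolynomial.pderiv i P) =
      MvPolynomial.C (MvPolynomial.coeff 0 (MvPolynomial.pderiv j (MvPolynomial.pderiv i P))) := fun j =>
    MvPolynomial.totalDegree_eq_zero_iff_eq_C.1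
      ((MvPolynomial.totalDegree_zero_iff_isHomogeneous _).2 h1.pderiv)
  have hE := h1.sum_X_mul_pderiv
  rw [one_smul] at hE
  conv_lhs => rw [← hE]
  rw [map_sum]
  refine Finset.sum_congr rfl fun j _ => ?_
  rw [map_mul, MvPolynomial.eval_X, hC j, MvPolynomial.eval_C, mul_comm]

/-! ## The kernel of a quadratic observable -/

/-- **The kernel, applied**: `A k l v = Σᵢⱼ (Mᵢⱼ/2) ⟪Gⱼ l, v⟫ Gᵢ k` for
`A k l = Σᵢⱼ (Mᵢⱼ/2) • ⟪Gⱼ l, ·⟫ • Gᵢ k`. [folklore] -/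
theorem kernel_apply {m : ℕ} (M : Fin m → Fin m → ℝ)
    (G : Fin m → (Fin 3 → ℤ) → EuclideanSpace ℂ (Fin 3)) (k l : Fin 3 → ℤ) (v : EuclideanSpace ℂ (Fin 3)) :
    (∑ i, ∑ j, ((M i j / 2 : ℝ) : ℂ) • ((innerₛₗ ℂ (G j l)).smulRight (G i k))) v =
      ∑ i, ∑ j, ((M i j / 2 : ℝ) : ℂ) • (inner ℂ (G j l) v • G i k) := by
  simp only [LinearMap.sum_apply, LinearMap.smul_apply, LinearMap.smulRight_apply, innerₛₗ_apply_apply]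

/-- **The kernel form, complex version** (pure algebra, any families):
`Σ_{k,l∈S} ⟪p k, A k l (q l)⟫ = Σᵢⱼ (Mᵢⱼ/2) (Σ_k ⟪p k, Gᵢ k⟫)(Σ_l ⟪Gⱼ l, q l⟫)`. [folklore] -/
theorem sum_sum_inner_kernel {m : ℕ} (M : Fin m → Fin m → ℝ)
    (G : Fin m → (Fin 3 → ℤ) → EuclideanSpace ℂ (Fin 3)) (S : Finset (Fin 3 → ℤ))
    (p q : (Fin 3 → ℤ) → EuclideanSpace ℂ (Fin 3)) :
    ∑ k ∈ S, ∑ l ∈ S, inner ℂ (p k)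
        ((∑ i, ∑ j, ((M i j / 2 : ℝ) : ℂ) • ((innerₛₗ ℂ (G j l)).smulRight (G i k))) (q l)) =
      ∑ i, ∑ j, ((M i j / 2 : ℝ) : ℂ) *
        ((∑ k ∈ S, inner ℂ (p k) (G i k)) * (∑ l ∈ S, inner ℂ (G j l) (q l))) := by
  simp only [kernel_apply, inner_sum, inner_smul_right]
  -- move the two outer summations (over `k`, `l`) inside the two inner ones (over `i`, `j`)
  rw [show ∀ f : (Fin 3 → ℤ) → (Fin 3 → ℤ) → Fin m → Fin m → ℂ,
      ∑ k ∈ S, ∑ l ∈ S, ∑ i, ∑ j, f k l i j = ∑ i, ∑ j, ∑ k ∈ S, ∑ l ∈ S, f k l i j from fun f => by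
    calc ∑ k ∈ S, ∑ l ∈ S, ∑ i, ∑ j, f k l i j
        = ∑ k ∈ S, ∑ i, ∑ j, ∑ l ∈ S, f k l i j := by
          refine Finset.sum_congr rfl fun k _ => ?_
          rw [Finset.sum_comm]
          exact Finset.sum_congr rfl fun i _ => Finset.sum_comm
      _ = ∑ i, ∑ k ∈ S, ∑ j, ∑ l ∈ S, f k l i j := Finset.sum_comm
      _ = ∑ i, ∑ j, ∑ k ∈ S, ∑ l ∈ S, f k l i j :=
          Finset.sum_congr rfl fun i _ => Finset.sum_comm]
  refine Finset.sum_congr rfl fun i _ => Finset.sum_congr rfl fun j _ => ?_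
  rw [Finset.sum_mul_sum, Finset.mul_sum]
  refine Finset.sum_congr rfl fun k _ => ?_
  rw [Finset.mul_sum]
  refine Finset.sum_congr rfl fun l _ => ?_
  ring

/-- **The kernel form, real version**: for conjugate-symmetric `p`, `q`, `Gᵢ` on a symmetric `S`,
`Σ_{k,l∈S} Re⟪p k, A k l (q l)⟫ = Σᵢⱼ (Mᵢⱼ/2) Yᵢ(p) Yⱼ(q)` with `Yᵢ(p) = Σ_{k∈S} Re⟪p k, Gᵢ k⟫`
(the `ℓ²(S)` pairings are real, `sum_inner_eq_ofReal`). [folklore] -/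
theorem sum_sum_re_inner_kernel {m : ℕ} (M : Fin m → Fin m → ℝ)
    {G : Fin m → (Fin 3 → ℤ) → EuclideanSpace ℂ (Fin 3)} {S : Finset (Fin 3 → ℤ)} (hS : ∀ k ∈ S, -k ∈ S)
    (hG : ∀ i, Torus.IsConjSymm (G i)) {p q : (Fin 3 → ℤ) → EuclideanSpace ℂ (Fin 3)}
    (hp : Torus.IsConjSymm p) (hq : Torus.IsConjSymm q) :
    ∑ k ∈ S, ∑ l ∈ S, (inner ℂ (p k)
        ((∑ i, ∑ j, ((M i j / 2 : ℝ) : ℂ) • ((innerₛₗ ℂ (G j l)).smulRight (G i k))) (q l))).re =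
      ∑ i, ∑ j, M i j / 2 *
        ((∑ k ∈ S, (inner ℂ (p k) (G i k)).re) * (∑ l ∈ S, (inner ℂ (q l) (G j l)).re)) := by
  have hswap : ∀ j, ∑ l ∈ S, (inner ℂ (G j l) (q l)).re = ∑ l ∈ S, (inner ℂ (q l) (G j l)).re :=
    fun j => Finset.sum_congr rfl fun l _ => re_inner_comm _ _
  calc ∑ k ∈ S, ∑ l ∈ S, (inner ℂ (p k)
        ((∑ i, ∑ j, ((M i j / 2 : ℝ) : ℂ) • ((innerₛₗ ℂ (G j l)).smulRight (G i k))) (q l))).re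
      = (∑ k ∈ S, ∑ l ∈ S, inner ℂ (p k)
          ((∑ i, ∑ j, ((M i j / 2 : ℝ) : ℂ) • ((innerₛₗ ℂ (G j l)).smulRight (G i k))) (q l))).re := by
        simp only [Complex.re_sum]
    _ = (∑ i, ∑ j, ((M i j / 2 : ℝ) : ℂ) *
          ((∑ k ∈ S, inner ℂ (p k) (G i k)) * (∑ l ∈ S, inner ℂ (G j l) (q l)))).re := by
        rw [sum_sum_inner_kernel]
    _ = (∑ i, ∑ j, ((M i j / 2 *
          ((∑ k ∈ S, (inner ℂ (p k) (G i k)).re) * (∑ l ∈ S, (inner ℂ (q l) (G j l)).re)) : ℝ) : ℂ)).re := by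
        congr 1
        refine Finset.sum_congr rfl fun i _ => Finset.sum_congr rfl fun j _ => ?_
        rw [sum_inner_eq_ofReal hS hp (hG i), sum_inner_eq_ofReal hS (hG j) hq, hswap j]
        push_cast
        ring
    _ = _ := by simp only [Complex.re_sum, Complex.ofReal_re]

/-- **The symmetrised kernel form is the differential of the observable**: for symmetric `M` and
conjugate-symmetric `p`, `q`, `Gᵢ` on a symmetric `S`,
`Φ(p,q) + Φ(q,p) = Σᵢ Yᵢ(q) · Σⱼ Mᵢⱼ Yⱼ(p)` (`= Σᵢ Yᵢ(q) ∂ᵢP(Y(p))`), where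
`Φ(p,q) = Σ_{k,l∈S} Re⟪p k, A k l (q l)⟫`. [folklore] -/
theorem form_add_form_swap {m : ℕ} {M : Fin m → Fin m → ℝ} (hM : ∀ i j, M i j = M j i)
    {G : Fin m → (Fin 3 → ℤ) → EuclideanSpace ℂ (Fin 3)} {S : Finset (Fin 3 → ℤ)} (hS : ∀ k ∈ S, -k ∈ S)
    (hG : ∀ i, Torus.IsConjSymm (G i)) {p q : (Fin 3 → ℤ) → EuclideanSpace ℂ (Fin 3)}
    (hp : Torus.IsConjSymm p) (hq : Torus.IsConjSymm q) :
    (∑ k ∈ S, ∑ l ∈ S, (inner ℂ (p k)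
        ((∑ i, ∑ j, ((M i j / 2 : ℝ) : ℂ) • ((innerₛₗ ℂ (G j l)).smulRight (G i k))) (q l))).re) +
      (∑ k ∈ S, ∑ l ∈ S, (inner ℂ (q k)
        ((∑ i, ∑ j, ((M i j / 2 : ℝ) : ℂ) • ((innerₛₗ ℂ (G j l)).smulRight (G i k))) (p l))).re) =
      ∑ i, (∑ k ∈ S, (inner ℂ (q k) (G i k)).re) *
        ∑ j, M i j * (∑ k ∈ S, (inner ℂ (p k) (G j k)).re) := by
  rw [sum_sum_re_inner_kernel M hS hG hp hq, sum_sum_re_inner_kernel M hS hG hq hp, Finset.sum_comm,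
    ← Finset.sum_add_distrib]
  refine Finset.sum_congr rfl fun i _ => ?_
  rw [Finset.mul_sum, ← Finset.sum_add_distrib]
  refine Finset.sum_congr rfl fun j _ => ?_
  rw [hM j i]
  ring

/-- **Bi-additivity of a kernel form** in the pair of families (any kernel of linear maps):
`Φ(p + p', q + q') = Φ(p,q) + Φ(p,q') + Φ(p',q) + Φ(p',q')`. [folklore] -/
theorem form_add_add (A : (Fin 3 → ℤ) → (Fin 3 → ℤ) → (EuclideanSpace ℂ (Fin 3) →ₗ[ℂ] EuclideanSpace ℂ (Fin 3)))
    (S : Finset (Fin 3 → ℤ)) (p p' q q' : (Fin 3 → ℤ) → EuclideanSpace ℂ (Fin 3)) :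
    ∑ k ∈ S, ∑ l ∈ S, (inner ℂ ((p + p') k) (A k l ((q + q') l))).re =
      (∑ k ∈ S, ∑ l ∈ S, (inner ℂ (p k) (A k l (q l))).re) +
        (∑ k ∈ S, ∑ l ∈ S, (inner ℂ (p k) (A k l (q' l))).re) +
        (∑ k ∈ S, ∑ l ∈ S, (inner ℂ (p' k) (A k l (q l))).re) +
        (∑ k ∈ S, ∑ l ∈ S, (inner ℂ (p' k) (A k l (q' l))).re) := by
  simp only [Pi.add_apply, map_add, inner_add_left, inner_add_right, Complex.add_re, Finset.sum_add_distrib]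
  ring

/-! ## Real trigonometric polynomials are linear in their coefficients -/

/-- `realTrigPoly S (Σᵢ rᵢ • Fᵢ) x = Σᵢ rᵢ • realTrigPoly S Fᵢ x` for real scalars `rᵢ`. [folklore] -/
theorem realTrigPoly_sum_ofReal_smul {ι : Type*} (s : Finset ι) (S : Finset (Fin 3 → ℤ)) (r : ι → ℝ)
    (F : ι → (Fin 3 → ℤ) → EuclideanSpace ℂ (Fin 3)) (x : UnitAddTorus (Fin 3)) :
    Torus.realTrigPoly S (fun k => ∑ i ∈ s, ((r i : ℝ) : ℂ) • F i k) x =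
      ∑ i ∈ s, r i • Torus.realTrigPoly S (F i) x := by
  simp only [Torus.realTrigPoly_apply, Torus.trigPoly_apply, Finset.smul_sum, map_sum]
  rw [Finset.sum_comm]
  refine Finset.sum_congr rfl fun i _ => Finset.sum_congr rfl fun k _ => ?_
  rw [← map_smul (EuclideanSpace.realPart (ι := Fin 3)), ← Complex.coe_smul, smul_comm]

/-- The real trigonometric polynomial of the DEFECT FAMILY
`k ↦ Σᵢ rᵢ Fᵢ k - a c k - b (2πi k × c k)` is the corresponding combination of fields. [folklore] -/
theorem realTrigPoly_defect {ι : Type*} [Fintype ι] (S : Finset (Fin 3 → ℤ)) (r : ι → ℝ)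
    (F : ι → (Fin 3 → ℤ) → EuclideanSpace ℂ (Fin 3)) (a b : ℝ) (c : (Fin 3 → ℤ) → EuclideanSpace ℂ (Fin 3))
    (x : UnitAddTorus (Fin 3)) :
    Torus.realTrigPoly S (fun k => (∑ i, ((r i : ℝ) : ℂ) • F i k) - ((a : ℝ) : ℂ) • c k -
        ((b : ℝ) : ℂ) • IntermittentBeltrami.curlCoeff c k) x =
      (∑ i, r i • Torus.realTrigPoly S (F i) x) - a • Torus.realTrigPoly S c x -
        b • Torus.realTrigPoly S (IntermittentBeltrami.curlCoeff c) x := by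
  have h1 : (fun k => (∑ i, ((r i : ℝ) : ℂ) • F i k) - ((a : ℝ) : ℂ) • c k -
      ((b : ℝ) : ℂ) • IntermittentBeltrami.curlCoeff c k) =
      (fun k => ∑ i, ((r i : ℝ) : ℂ) • F i k) - (fun k => ((a : ℝ) : ℂ) • c k) -
        (fun k => ((b : ℝ) : ℂ) • IntermittentBeltrami.curlCoeff c k) := rfl
  rw [h1, Torus.realTrigPoly_sub, Torus.realTrigPoly_sub, Pi.sub_apply, Pi.sub_apply,
    realTrigPoly_sum_ofReal_smul, IntermittentBeltrami.realTrigPoly_ofReal_smul,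
    IntermittentBeltrami.realTrigPoly_ofReal_smul]

/-! ## The Fourier dictionary for level-`N` fields -/

/-- The Fourier coefficients of an element of `H` are conjugate symmetric. [folklore] -/
theorem isConjSymm_coe (u : Torus.energySpace (Fin 3)) :
    Torus.IsConjSymm fun k => mFourierCoeff (EuclideanSpace.complexify ∘
      (u.1 : UnitAddTorus (Fin 3) → EuclideanSpace ℝ (Fin 3))) k :=
  Torus.isConjSymm_mFourierCoeff ((Lp.memLp u.1).integrable one_le_two)

/-- The Fourier coefficients of an element of `H` are transversal (weak divergence-freeness). [folklore] -/
theorem isTransversal_coe (u : Torus.energySpace (Fin 3)) (S : Finset (Fin 3 → ℤ)) :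
    Torus.IsTransversal S fun k => mFourierCoeff (EuclideanSpace.complexify ∘
      (u.1 : UnitAddTorus (Fin 3) → EuclideanSpace ℝ (Fin 3))) k :=
  (Torus.isWeaklyDivFree_of_mem_energySpace u.2).isTransversal_mFourierCoeff (Lp.memLp u.1) S

/-- **A level-`N` field is the real trigonometric polynomial of its coefficients over the punctured
ball**, almost everywhere (`P_N u = u` a.e., and `û = 0` off the punctured ball). [folklore] -/
theorem coe_ae_eq_realTrigPoly_of_level {N : ℕ} (u : Torus.energySpace (Fin 3))
    (hu : ∀ k ∉ (Torus.freqBall N).erase (0 : Fin 3 → ℤ),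
      mFourierCoeff (EuclideanSpace.complexify ∘ (u.1 : UnitAddTorus (Fin 3) → EuclideanSpace ℝ (Fin 3))) k = 0) :
    ((u.1 : Lp (EuclideanSpace ℝ (Fin 3)) 2 (volume : Measure (UnitAddTorus (Fin 3)))) :
        UnitAddTorus (Fin 3) → EuclideanSpace ℝ (Fin 3)) =ᵐ[volume]
      Torus.realTrigPoly ((Torus.freqBall N).erase 0) fun k =>
        mFourierCoeff (EuclideanSpace.complexify ∘ (u.1 : UnitAddTorus (Fin 3) → EuclideanSpace ℝ (Fin 3))) k := by
  refine (CubicParityLoud.Negative.fourierTruncate_ae_eq_of_isLevel hu).symm.trans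
    (Eventually.of_forall fun x => ?_)
  show Torus.fourierTruncate N _ x = _
  rw [Torus.fourierTruncate_eq, Torus.realTrigPoly_eq_comp, Torus.realTrigPoly_eq_comp,
    Torus.trigPoly_subset (Finset.erase_subset 0 (Torus.freqBall N)) (fun k _ hk => hu k hk)]

/-- **Every admissible coefficient family is the coefficient family of a level-`N` field of `H`**
(the class of `realTrigPoly S c`). [folklore] -/
theorem exists_level_of_admissible :
    ∀ {N : ℕ} {c : (Fin 3 → ℤ) → EuclideanSpace ℂ (Fin 3)},
    Torus.IsConjSymm c → Torus.IsTransversal ((Torus.freqBall N).erase 0) c →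
    (∀ k ∉ (Torus.freqBall N).erase (0 : Fin 3 → ℤ), c k = 0) →
    ∃ U : Torus.energySpace (Fin 3),
      (∀ k ∉ (Torus.freqBall N).erase (0 : Fin 3 → ℤ),
        mFourierCoeff (EuclideanSpace.complexify ∘ (U.1 : UnitAddTorus (Fin 3) → EuclideanSpace ℝ (Fin 3))) k = 0) ∧
      (((U.1 : Lp (EuclideanSpace ℝ (Fin 3)) 2 (volume : Measure (UnitAddTorus (Fin 3)))) :
          UnitAddTorus (Fin 3) → EuclideanSpace ℝ (Fin 3)) =ᵐ[volume]
        Torus.realTrigPoly ((Torus.freqBall N).erase 0) c) ∧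
      (fun k => mFourierCoeff (EuclideanSpace.complexify ∘
        (U.1 : UnitAddTorus (Fin 3) → EuclideanSpace ℝ (Fin 3))) k) = c := by
  intro N c hc hT h0
  obtain ⟨U, hU⟩ := exists_energySpace_coe_ae_eq_realTrigPoly N c hT
  refine ⟨U, level_of_ae_eq hU hc, hU, funext fun k => ?_⟩
  rw [mFourierCoeff_coe_of_ae_eq hU hc]
  split_ifs with hk
  · rfl
  · exact (h0 k hk).symm

/-- **The Euler derivative of a combination of band tests, in coefficients.** If `U ∈ H` is represented
by `realTrigPoly S c` (`c` conjugate symmetric and transversal, `S` the punctured ball) and the `gᵢ`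
are band tests, then for real `κᵢ`:
`nsGeneratorPairing 0 0 U (Σᵢ κᵢ gᵢ) = -Σᵢ κᵢ Σ_{k∈S} Re⟪Π_k 𝓕[(w·∇)w](k), ĝᵢ k⟫`
(finite Parseval; the Leray symbol is invisible against the transversal `ĝᵢ k`). [folklore] -/
theorem nsGeneratorPairing_zero_zero_sum_smul_eq {N m : ℕ} {c : (Fin 3 → ℤ) → EuclideanSpace ℂ (Fin 3)}
    (hc : Torus.IsConjSymm c) (hT : Torus.IsTransversal ((Torus.freqBall N).erase 0) c)
    {U : Torus.energySpace (Fin 3)}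
    (hU : ((U.1 : Lp (EuclideanSpace ℝ (Fin 3)) 2 (volume : Measure (UnitAddTorus (Fin 3)))) :
        UnitAddTorus (Fin 3) → EuclideanSpace ℝ (Fin 3)) =ᵐ[volume]
      Torus.realTrigPoly ((Torus.freqBall N).erase 0) c)
    {g : Fin m → UnitAddTorus (Fin 3) → EuclideanSpace ℝ (Fin 3)}
    (hg : ∀ i, Torus.IsSmooth (g i) ∧ Torus.IsDivFree (g i) ∧ Torus.HasZeroMean (g i) ∧
      ∀ k ∉ (Torus.freqBall N).erase (0 : Fin 3 → ℤ),
        mFourierCoeff (EuclideanSpace.complexify ∘ (g i)) k = 0)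
    (κ : Fin m → ℝ) :
    Torus.nsGeneratorPairing (d := Fin 3) 0 0 U (fun x => ∑ i, κ i • g i x) =
      -∑ i, κ i * ∑ k ∈ (Torus.freqBall N).erase 0,
        (inner ℂ (Torus.leraySym k (Torus.convectionCoeff ((Torus.freqBall N).erase 0) c c k))
          (mFourierCoeff (EuclideanSpace.complexify ∘ (g i)) k)).re := by
  have hw := sum_smul_band Finset.univ κ hg
  rw [nsGeneratorPairing_zero_zero_eq_inertialPairing, inertialPairing_of_ae_eq hU hc hT hw.1 hw.2.2.2]
  congr 1
  simp_rw [mFourierCoeff_complexify_sum_smul Finset.univ κ (fun i => (hg i).1.continuous), inner_sum,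
    Complex.re_sum, inner_smul_right, Complex.re_ofReal_mul]
  rw [Finset.sum_comm]
  refine Finset.sum_congr rfl fun i _ => ?_
  rw [Finset.mul_sum]
  refine Finset.sum_congr rfl fun k _ => ?_
  rw [Torus.inner_leraySym_left_of_transversal _ _ ((hg i).2.1.sum_mul_mFourierCoeff_eq_zero (hg i).1 k)]

end CoefficientBridge

end Summit.AnomalousDissipation.AnomalousDissipation.Theorems.MomentParityCubicParityLoud
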